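import Literature.MathematicalPhysics.QuantumLattice.StabilityLocalityCoreProofs
import HarnessLib

/-!
# The reduction chain with the coupling factor `√|ε|`

Top-down layer (seat B) of the formalisation of the Michalakis–Zwolak stability theorem
(hubbard.S19, `Literature.MathematicalPhysics.QuantumLattice.michalakis_zwolak`). The reductions
`michalakis_zwolak_of_coreA` → `…_of_termwise_core` → `…_of_flow_decomposition_core` →
`…_of_flow_locality_core'` → `…_of_locality_core` ask for quasi-local pieces of the rotated
`Φ`-terms bounded by `|ε| B_p/(ℓ+1)^p`. The final argument (MZ13 §7) only needs a prefactor
`η(ε) ≤ 1` with `η(ε) → 0` (`η c_* ≤ 1/3` for `|ε| < ε₀`); here the whole chain is re-derived with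
`η = √|ε|` (`…_sqrt`), which is what the analytic side delivers cheaply: pieces bounded both by an
`O(ε)` norm estimate (`X⁽¹⁾`, `X⁽²⁾` are `O(ε)`, MZ13 Lemma 1 (v), Lemma 2) and by `ε`-independent
tails satisfy `‖·‖ ≤ min(εa, b/(ℓ+1)^{2p}) ≤ √ε √(ab)/(ℓ+1)^p`. The proofs are those of the
unprimed chain, verbatim up to the prefactor (`ε₁` is squared in the first step).
No definitions, no named facts (theorems only).
-/

noncomputable section

open Matrix Finset Module MeasureTheory Complex Filter Topology
open scoped InnerProductSpace ComplexOrder Matrix.Norms.L2Operator SchwartzMap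

namespace Literature.MathematicalPhysics.QuantumLattice

open Literature.Probability.LatticeModels

universe u

variable (d q : ℕ) {κ : Type u} [Fintype κ] [DecidableEq κ]

/-- **`michalakis_zwolak` from per-volume spectral-flow data, prefactor `√|ε|`** (copy of
`michalakis_zwolak_of_coreA` with `ε₁` squared). [cite: MichalakisZwolakCMP2013, Thm. 1, §5.2 + §7 (arXiv:1109.1588 pp. 11–16)] -/
theorem michalakis_zwolak_of_coreA_sqrt
    (hA : ∀ (Φ : (L : ℕ) → Interaction (TorusSite d L × κ) q) (m : ℕ → ℕ) (γ : ℝ) (r₀ : ℕ)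
      (Δ γloc : ℕ → ℝ),
      (∀ (L : ℕ) [NeZero L], IsProjectorInteraction (Φ L) ∧ (Φ L).IsLocal) →
      (∀ (L : ℕ) [NeZero L], IsFrustrationFree (Φ L) univ) →
      (∀ (L : ℕ) [NeZero L] (X : Finset (TorusSite d L × κ)), r₀ < torusDiam X → Φ L X = 0) →
      (0 < γ ∧ ∀ (L : ℕ) [NeZero L], (localHamiltonian (Φ L) univ).HasClusterGap (m L) 0 γ) →
      HasUniformLTQO Φ Δ → HasFastDecay Δ → HasUniformLocalGap Φ γloc →
      (∃ c : ℝ, ∃ p : ℕ, 0 < c ∧ ∀ ℓ : ℕ, c / ((ℓ : ℝ) + 1) ^ p ≤ γloc ℓ) →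
      ∀ (r : ℕ) (V : (L : ℕ) → Interaction (TorusSite d L × κ) q),
        (∀ (L : ℕ) [NeZero L], (V L).IsLocal ∧
          (∀ X, r < torusDiam X → V L X = 0) ∧ ∀ X, ‖V L X‖ ≤ 1) →
        ∃ L_A : ℕ, ∃ φ : ℕ → ℝ, HasFastDecay φ ∧ (∀ i, 0 ≤ φ i) ∧
          ∀ ε : ℝ, |ε| ≤ 1 → ∀ (L : ℕ) [NeZero L], L_A ≤ L → ∀ s ∈ Set.Icc (0 : ℝ) 1,
            (∀ t ∈ Set.Icc (0 : ℝ) s, ∃ ω : ℝ, ω ≤ γ ∧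
              (localHamiltonian (Φ L) univ +
                (t : ℂ) • ((ε : ℂ) • localHamiltonian (V L) univ)).HasClusterGap (m L) ω (γ / 2)) →
            ∃ (U : Op (TorusSite d L × κ) q) (X : TorusSite d L → ℕ → Op (TorusSite d L × κ) q),
              U ∈ unitary (Op (TorusSite d L × κ) q) ∧
              star U * (localHamiltonian (Φ L) univ +
                (s : ℂ) • ((ε : ℂ) • localHamiltonian (V L) univ)) * U =
                localHamiltonian (Φ L) univ + ∑ u, ∑ i ∈ range (L + 1), X u i ∧
              (∀ u i, IsSupportedOn (X u i) (cellBall u i)) ∧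
              (∀ u i, (X u i).IsHermitian) ∧
              (∀ u, Commute (∑ i ∈ range (L + 1), X u i) (localGroundProj (Φ L) univ)) ∧
              (∀ u i, ‖X u i‖ ≤ Real.sqrt |ε| * φ i)) :
    michalakis_zwolak (κ := κ) d q := by
  refine michalakis_zwolak_of_latticeCore d q ?_
  intro Φ m γ r₀ Δ γloc hproj hff hrange hgap hltqo hΔ hloc hγloc r V hV
  obtain ⟨L_A, φ, hφ, hφ0, hXA⟩ :=
    hA Φ m γ r₀ Δ γloc hproj hff hrange hgap hltqo hΔ hloc hγloc r V hV
  obtain ⟨c₀, p₀, hc₀, hγloc'⟩ := hγloc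
  -- the non-negative LTQO rate
  set Δp : ℕ → ℝ := fun ℓ => max (Δ ℓ) 0 with hΔpdef
  have hΔp0 : ∀ ℓ, 0 ≤ Δp ℓ := fun ℓ => le_max_right _ _
  have hltqop : HasUniformLTQO Φ Δp := hltqo.mono fun ℓ => le_max_left _ _
  have hΔp : HasFastDecay Δp := by
    refine hΔ.trans_abs_le fun ℓ => ?_
    rw [abs_of_nonneg (hΔp0 ℓ)]
    exact max_le (le_abs_self _) (abs_nonneg _)
  -- constants
  set a : ℕ := d + p₀ with hadef
  obtain ⟨Fb, hFb0, hFb⟩ := exists_sum_majorant hφ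
  obtain ⟨Gc, hGc0, hGcL⟩ := exists_lemma3_majorant hφ hΔp hΔp0 (a + 1)
  obtain ⟨Kτ, hKτ0, hKτ⟩ := exists_tail_majorant hφ (a + 2)
  obtain ⟨Kσ, hKσ0, hKσ⟩ := exists_sqrt_majorant hΔp (a + 2)
  set cstar : ℝ := (2 : ℝ) ^ d / c₀ * (2 * Fb + 4 * Gc + (2 : ℝ) ^ (d + p₀) * (16 * Kτ + 8 * Fb * Kσ))
    with hcstardef
  have hcstar0 : 0 ≤ cstar := by positivity
  have hγpos : ∀ j, 0 < γloc j := fun j => lt_of_lt_of_le (by positivity) (hγloc' j)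
  refine ⟨min 1 ((1 / (3 * cstar + 3)) ^ 2), by positivity, L_A,
    fun L => 2 * Gc * (1 / ((L : ℝ) + 1)), ?_, ?_⟩
  · -- the splitting decays
    have h := (tendsto_one_div_add_atTop_nhds_zero_nat).const_mul (2 * Gc)
    rw [mul_zero] at h
    exact h
  intro ε hε L _ hL s hs hprev
  have hε1 : |ε| ≤ 1 := hε.le.trans (min_le_left _ _)
  have hη0 : 0 ≤ Real.sqrt |ε| := Real.sqrt_nonneg _
  have hη1 : Real.sqrt |ε| ≤ 1 := Real.sqrt_le_one.mpr hε1
  have hεc : Real.sqrt |ε| * cstar ≤ 1 / 3 := by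
    have h0 : |ε| < (1 / (3 * cstar + 3)) ^ 2 := hε.trans_le (min_le_right _ _)
    have h1 : Real.sqrt |ε| < 1 / (3 * cstar + 3) := by
      have h := Real.sqrt_lt_sqrt (abs_nonneg ε) h0
      rwa [Real.sqrt_sq (by positivity)] at h
    have h2 : Real.sqrt |ε| * cstar ≤ 1 / (3 * cstar + 3) * cstar :=
      mul_le_mul_of_nonneg_right h1.le hcstar0
    have h3 : 1 / (3 * cstar + 3) * cstar ≤ 1 / 3 := by
      rw [div_mul_eq_mul_div, one_mul, div_le_div_iff₀ (by positivity) (by norm_num)]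
      linarith
    exact h2.trans h3
  have hδ0 : 0 ≤ 2 * Gc * (1 / ((L : ℝ) + 1)) := by positivity
  rcases isEmpty_or_nonempty (TensorIndex (TorusSite d L × κ) q) with hemp | hne
  · -- empty configuration space: all operators vanish
    refine ⟨1, 0, 0, 0, one_mem _, Subsingleton.elim _ _, fun x => ?_, fun x _ => ?_,
      fun x => ?_, ?_⟩
    · have hx : x = 0 := Subsingleton.elim _ _
      subst hx
      simp
    · simp
    · simp
    · rw [norm_zero]; exact hδ0
  -- the spectral-flow data at this volume
  obtain ⟨U, X, hU, hdec, hXs, hXh, hXc, hXn⟩ := hXA ε hε1 L hL s hs hprev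
  have hP0 : ∀ (x : TorusSite d L) (r : ℕ),
      localGroundProj (Φ L) (cellBall x r : Finset (TorusSite d L × κ)) ≠ 0 :=
    fun x r => localGroundProj_ne_zero_of_hasLocalGap (hloc L) x r
  have hL1 : 1 ≤ L := NeZero.one_le
  have hL1r : (0 : ℝ) < (L : ℝ) + 1 := by positivity
  obtain ⟨W, D, e, hid, hWker, hHD, hDn, hWform⟩ :=
    exists_package_of_rotated_decomposition (hproj L).1 (hproj L).2 (hltqop L) hΔp0 (hloc L)
      hγpos hP0 X hdec hXs hXh hXc hη0 hφ0 hXn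
      (G := Gc / ((L : ℝ) + 1) ^ (a + 1)) (Fb := Fb) (τ := fun j => Kτ / ((j : ℝ) + 1) ^ (a + 2))
      (σ := fun j => Kσ / ((j : ℝ) + 1) ^ (a + 2)) (by positivity) hFb0 (fun j => by positivity)
      (fun j => by positivity) (hGcL L hL1) (hFb (L + 1)) (fun j => hKτ j (L + 1)) (fun j => hKσ j)
  refine ⟨U, W, D, e, hU, hid, fun x => ?_, hWker, fun x _ => hHD x, ?_⟩
  · -- the relative form bound with `β = 1/3`
    have h1 := hWform x
    have hc : (∑ j ∈ range (L + 1), (2 * (j : ℝ) + 1) ^ d *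
        (if j = 0 then 2 * Fb
          else if 2 * (j - 1) < L then 4 * (Gc / ((L : ℝ) + 1) ^ (a + 1)) +
            8 * (Kτ / ((((j - 1 : ℕ)) : ℝ) + 1) ^ (a + 2)) +
            4 * Fb * (Kσ / ((((j - 1 : ℕ)) : ℝ) + 1) ^ (a + 2)) else 0) / γloc j) ≤ cstar := by
      have h := relative_constant_le (L := L) (d := d) (p₀ := p₀) (Gc := Gc)
        (τ := fun j => Kτ / ((j : ℝ) + 1) ^ (a + 2)) (σ := fun j => Kσ / ((j : ℝ) + 1) ^ (a + 2))
        hc₀ hγloc' hFb0 (G := Gc / ((L : ℝ) + 1) ^ (a + 1)) (by positivity)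
        (fun j => by positivity) (fun j => by positivity) hKτ0 hKσ0
        (by rw [hadef, div_mul_cancel₀ _ (pow_ne_zero _ hL1r.ne')])
        (fun j => by rw [hadef, div_mul_cancel₀ _ (pow_ne_zero _ (by positivity))])
        (fun j => by rw [hadef, div_mul_cancel₀ _ (pow_ne_zero _ (by positivity))])
      simpa only [hadef] using h
    have hre0 : 0 ≤ RCLike.re ⟪x, toEuclideanLin (localHamiltonian (Φ L) univ) x⟫_ℂ :=
      re_inner_toEuclideanLin_nonneg_of_posSemidef ((hproj L).1.posSemidef_localHamiltonian univ) x
    have hkey : ‖⟪x, toEuclideanLin W x⟫_ℂ‖ ≤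
        1 / 3 * RCLike.re ⟪x, toEuclideanLin (localHamiltonian (Φ L) univ) x⟫_ℂ := by
      refine h1.trans ?_
      refine mul_le_mul_of_nonneg_right ?_ hre0
      calc Real.sqrt |ε| * _ ≤ Real.sqrt |ε| * cstar := mul_le_mul_of_nonneg_left hc hη0
        _ ≤ 1 / 3 := hεc
    have hre : -‖⟪x, toEuclideanLin W x⟫_ℂ‖ ≤ RCLike.re ⟪x, toEuclideanLin W x⟫_ℂ :=
      (abs_le.mp (RCLike.abs_re_le_norm ⟪x, toEuclideanLin W x⟫_ℂ)).1
    linarith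
  · -- the splitting bound `‖D‖ ≤ 2 Gc/(L+1)`
    have hcard : (Fintype.card (TorusSite d L) : ℝ) ≤ ((L : ℝ) + 1) ^ d := by
      have h1 : Fintype.card (TorusSite d L) = L ^ d := by
        rw [Fintype.card_fun, ZMod.card, Fintype.card_fin]
      rw [h1]
      push_cast
      exact pow_le_pow_left₀ (Nat.cast_nonneg _) (by linarith) d
    have hpow : ((L : ℝ) + 1) ^ d / ((L : ℝ) + 1) ^ (a + 1) ≤ 1 / ((L : ℝ) + 1) := by
      rw [show a + 1 = d + (p₀ + 1) by omega, pow_add, div_mul_eq_div_div,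
        div_self (pow_ne_zero _ hL1r.ne')]
      refine one_div_le_one_div_of_le hL1r ?_
      calc (L : ℝ) + 1 = ((L : ℝ) + 1) ^ 1 := (pow_one _).symm
        _ ≤ ((L : ℝ) + 1) ^ (p₀ + 1) := pow_le_pow_right₀ (by linarith) (by omega)
    calc ‖D‖ ≤ Fintype.card (TorusSite d L) * (2 * Real.sqrt |ε| * (Gc / ((L : ℝ) + 1) ^ (a + 1))) :=
          hDn
      _ ≤ ((L : ℝ) + 1) ^ d * (2 * 1 * (Gc / ((L : ℝ) + 1) ^ (a + 1))) := by
          apply mul_le_mul hcard _ (by positivity) (by positivity)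
          gcongr
      _ = 2 * Gc * (((L : ℝ) + 1) ^ d / ((L : ℝ) + 1) ^ (a + 1)) := by ring
      _ ≤ 2 * Gc * (1 / ((L : ℝ) + 1)) := mul_le_mul_of_nonneg_left hpow (by positivity)

/-- **Term-wise form, prefactor `√|ε|`** (copy of `michalakis_zwolak_of_termwise_core`).
[cite: MichalakisZwolakCMP2013, Thm. 1, §5.2 (arXiv:1109.1588 pp. 11–12)] -/
theorem michalakis_zwolak_of_termwise_core_sqrt
    (hT : ∀ (Φ : (L : ℕ) → Interaction (TorusSite d L × κ) q) (m : ℕ → ℕ) (γ : ℝ) (r₀ : ℕ)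
      (Δ γloc : ℕ → ℝ),
      (∀ (L : ℕ) [NeZero L], IsProjectorInteraction (Φ L) ∧ (Φ L).IsLocal) →
      (∀ (L : ℕ) [NeZero L], IsFrustrationFree (Φ L) univ) →
      (∀ (L : ℕ) [NeZero L] (X : Finset (TorusSite d L × κ)), r₀ < torusDiam X → Φ L X = 0) →
      (0 < γ ∧ ∀ (L : ℕ) [NeZero L], (localHamiltonian (Φ L) univ).HasClusterGap (m L) 0 γ) →
      HasUniformLTQO Φ Δ → HasFastDecay Δ → HasUniformLocalGap Φ γloc →
      (∃ c : ℝ, ∃ p : ℕ, 0 < c ∧ ∀ ℓ : ℕ, c / ((ℓ : ℝ) + 1) ^ p ≤ γloc ℓ) →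
      ∀ (r : ℕ) (V : (L : ℕ) → Interaction (TorusSite d L × κ) q),
        (∀ (L : ℕ) [NeZero L], (V L).IsLocal ∧
          (∀ X, r < torusDiam X → V L X = 0) ∧ ∀ X, ‖V L X‖ ≤ 1) →
        ∃ L_A : ℕ, ∃ N : ℕ, ∃ B : ℕ → ℝ,
          ∀ ε : ℝ, |ε| ≤ 1 → ∀ (L : ℕ) [NeZero L], L_A ≤ L → ∀ s ∈ Set.Icc (0 : ℝ) 1,
            (∀ t ∈ Set.Icc (0 : ℝ) s, ∃ ω : ℝ, ω ≤ γ ∧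
              (localHamiltonian (Φ L) univ +
                (t : ℂ) • ((ε : ℂ) • localHamiltonian (V L) univ)).HasClusterGap (m L) ω (γ / 2)) →
            ∃ (U : Op (TorusSite d L × κ) q) (G : Type u) (_ : Fintype G) (c : G → TorusSite d L)
              (Y : G → ℕ → Op (TorusSite d L × κ) q),
              U ∈ unitary (Op (TorusSite d L × κ) q) ∧
              star U * (localHamiltonian (Φ L) univ +
                (s : ℂ) • ((ε : ℂ) • localHamiltonian (V L) univ)) * U =
                localHamiltonian (Φ L) univ + ∑ g, ∑ ℓ ∈ range (L + 1), Y g ℓ ∧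
              (∀ g ℓ, IsSupportedOn (Y g ℓ) (cellBall (c g) ℓ)) ∧
              (∀ g ℓ, (Y g ℓ).IsHermitian) ∧
              (∀ g, Commute (∑ ℓ ∈ range (L + 1), Y g ℓ) (localGroundProj (Φ L) univ)) ∧
              (∀ g ℓ (p : ℕ), ‖Y g ℓ‖ ≤ Real.sqrt |ε| * (B p / ((ℓ : ℝ) + 1) ^ p)) ∧
              (∀ u, (univ.filter fun g => c g = u).card ≤ N)) :
    michalakis_zwolak (κ := κ) d q := by
  refine michalakis_zwolak_of_coreA_sqrt d q ?_
  intro Φ m γ r₀ Δ γloc hproj hff hrange hgap hltqo hΔ hloc hγloc r V hV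
  obtain ⟨L_A, N, B, hcore⟩ := hT Φ m γ r₀ Δ γloc hproj hff hrange hgap hltqo hΔ hloc hγloc r V hV
  -- the profile
  set ψ : ℕ → ℝ := fun i => ⨅ p : ℕ, max (B p) 0 / ((i : ℝ) + 1) ^ p with hψdef
  have hψ : HasFastDecay ψ := hasFastDecay_iInf_pow_bound B
  have hψ0 : ∀ i, 0 ≤ ψ i := iInf_pow_bound_nonneg B
  refine ⟨L_A, fun i => (N : ℝ) * ψ i, hψ.const_mul (N : ℝ),
    fun i => mul_nonneg (Nat.cast_nonneg N) (hψ0 i), ?_⟩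
  intro ε hε L _ hL s hs hprev
  obtain ⟨U, G, instG, c, Y, hU, hdec, hYs, hYh, hYc, hYn, hN⟩ := hcore ε hε L hL s hs hprev
  have hYn' : ∀ g ℓ, ‖Y g ℓ‖ ≤ Real.sqrt |ε| * ψ ℓ := by
    intro g ℓ
    by_cases hε0 : ε = 0
    · -- `ε = 0`: the pieces vanish
      have h := hYn g ℓ 0
      simp only [hε0, abs_zero, Real.sqrt_zero, zero_mul] at h ⊢
      exact h
    · have hεpos : 0 < Real.sqrt |ε| := Real.sqrt_pos.mpr (abs_pos.mpr hε0)
      rw [← div_le_iff₀' hεpos]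
      refine le_ciInf fun p => ?_
      rw [div_le_iff₀' hεpos]
      refine (hYn g ℓ p).trans (mul_le_mul_of_nonneg_left ?_ hεpos.le)
      exact div_le_div_of_nonneg_right (le_max_left _ _) (by positivity)
  obtain ⟨hsum, hXs, hXh, hXc, hXn⟩ := regroup_by_centre c Y (localGroundProj (Φ L) univ) hYs hYh
    hYc (Real.sqrt_nonneg _) hYn' hN hψ0
  refine ⟨U, fun u ℓ => ∑ g ∈ univ.filter (fun g => c g = u), Y g ℓ, hU, ?_, hXs, hXh, hXc, hXn⟩
  rw [hdec, hsum]

/-- **Flow-decomposition form, prefactor `√|ε|`** (copy of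
`michalakis_zwolak_of_flow_decomposition_core`; `exists_termwise_of_flow_decomposition` is applied
with its coupling parameter `√|ε|`, using `|sε| ≤ |ε| ≤ √|ε|`).
[cite: MichalakisZwolakCMP2013, Thm. 1, §5.2 Prop. 1 (arXiv:1109.1588 pp. 11–12)] -/
theorem michalakis_zwolak_of_flow_decomposition_core_sqrt
    (hF : ∀ (Φ : (L : ℕ) → Interaction (TorusSite d L × κ) q) (m : ℕ → ℕ) (γ : ℝ) (r₀ : ℕ)
      (Δ γloc : ℕ → ℝ),
      (∀ (L : ℕ) [NeZero L], IsProjectorInteraction (Φ L) ∧ (Φ L).IsLocal) →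
      (∀ (L : ℕ) [NeZero L], IsFrustrationFree (Φ L) univ) →
      (∀ (L : ℕ) [NeZero L] (X : Finset (TorusSite d L × κ)), r₀ < torusDiam X → Φ L X = 0) →
      (0 < γ ∧ ∀ (L : ℕ) [NeZero L], (localHamiltonian (Φ L) univ).HasClusterGap (m L) 0 γ) →
      HasUniformLTQO Φ Δ → HasFastDecay Δ → HasUniformLocalGap Φ γloc →
      (∃ c : ℝ, ∃ p : ℕ, 0 < c ∧ ∀ ℓ : ℕ, c / ((ℓ : ℝ) + 1) ^ p ≤ γloc ℓ) →
      ∀ (r : ℕ) (V : (L : ℕ) → Interaction (TorusSite d L × κ) q),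
        (∀ (L : ℕ) [NeZero L], (V L).IsLocal ∧
          (∀ X, r < torusDiam X → V L X = 0) ∧ ∀ X, ‖V L X‖ ≤ 1) →
        ∃ L_A : ℕ, ∃ Bd : ℕ → ℝ,
          ∀ ε : ℝ, |ε| ≤ 1 → ∀ (L : ℕ) [NeZero L], L_A ≤ L → ∀ s ∈ Set.Icc (0 : ℝ) 1,
            (∀ t ∈ Set.Icc (0 : ℝ) s, ∃ ω : ℝ, ω ≤ γ ∧
              (localHamiltonian (Φ L) univ +
                (t : ℂ) • ((ε : ℂ) • localHamiltonian (V L) univ)).HasClusterGap (m L) ω (γ / 2)) →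
            ∃ (U Ps : Op (TorusSite d L × κ) q)
              (Fs F0 : Op (TorusSite d L × κ) q → Op (TorusSite d L × κ) q)
              (c₁ c₂ : Finset (TorusSite d L × κ) → TorusSite d L)
              (A B : Finset (TorusSite d L × κ) → ℕ → Op (TorusSite d L × κ) q),
              U ∈ unitary (Op (TorusSite d L × κ) q) ∧
              star U * Ps * U = localGroundProj (Φ L) univ ∧
              (∀ X Y, Fs (X + Y) = Fs X + Fs Y) ∧ (∀ (a : ℂ) X, Fs (a • X) = a • Fs X) ∧
              Fs (∑ Z, Φ L Z + ((s * ε : ℝ) : ℂ) • ∑ Z, V L Z) =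
                ∑ Z, Φ L Z + ((s * ε : ℝ) : ℂ) • ∑ Z, V L Z ∧
              (∀ O, Commute (Fs O) Ps) ∧
              (∀ X Y, F0 (X + Y) = F0 X + F0 Y) ∧ (∀ (a : ℂ) X, F0 (a • X) = a • F0 X) ∧
              F0 (∑ Z, Φ L Z) = ∑ Z, Φ L Z ∧
              (∀ O, Commute (F0 O) (localGroundProj (Φ L) univ)) ∧
              (∀ Z, Φ L Z ≠ 0 → Z ⊆ cellBall (c₁ Z) r₀) ∧
              (∀ Z, V L Z ≠ 0 → Z ⊆ cellBall (c₂ Z) r) ∧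
              (∀ Z, Φ L Z ≠ 0 →
                ∑ ℓ ∈ range (L + 1), A Z ℓ = star U * Fs (Φ L Z) * U - F0 (Φ L Z)) ∧
              (∀ Z, V L Z ≠ 0 → ∑ ℓ ∈ range (L + 1), B Z ℓ = star U * Fs (V L Z) * U) ∧
              (∀ Z ℓ, IsSupportedOn (A Z ℓ) (cellBall (c₁ Z) ℓ)) ∧
              (∀ Z ℓ, IsSupportedOn (B Z ℓ) (cellBall (c₂ Z) ℓ)) ∧
              (∀ Z ℓ, (A Z ℓ).IsHermitian) ∧ (∀ Z ℓ, (B Z ℓ).IsHermitian) ∧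
              (∀ Z ℓ (p : ℕ), ‖A Z ℓ‖ ≤ Real.sqrt |ε| * (Bd p / ((ℓ : ℝ) + 1) ^ p)) ∧
              (∀ Z ℓ (p : ℕ), ‖B Z ℓ‖ ≤ Bd p / ((ℓ : ℝ) + 1) ^ p)) :
    michalakis_zwolak (κ := κ) d q := by
  refine michalakis_zwolak_of_termwise_core_sqrt d q ?_
  intro Φ m γ r₀ Δ γloc hproj hff hrange hgap hltqo hΔ hloc hγloc r V hV
  obtain ⟨L_A, Bd, h⟩ := hF Φ m γ r₀ Δ γloc hproj hff hrange hgap hltqo hΔ hloc hγloc r V hV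
  refine ⟨L_A, 2 ^ ((2 * r₀ + 1) ^ d * Fintype.card κ) + 2 ^ ((2 * r + 1) ^ d * Fintype.card κ),
    Bd, ?_⟩
  intro ε hε L _ hL s hs hprev
  obtain ⟨U, Ps, Fs, F0, c₁, c₂, A, B, hU, hUP, hFs_add, hFs_smul, hFs_H, hFs_comm, hF0_add,
    hF0_smul, hF0_H, hF0_comm, hc₁, hc₂, hAsum, hBsum, hAs, hBs, hAh, hBh, hAn, hBn⟩ :=
    h ε hε L hL s hs hprev
  have hHs : localHamiltonian (Φ L) univ + (s : ℂ) • ((ε : ℂ) • localHamiltonian (V L) univ) =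
      ∑ Z, Φ L Z + ((s * ε : ℝ) : ℂ) • ∑ Z, V L Z := by
    rw [localHamiltonian_univ_eq_sum, localHamiltonian_univ_eq_sum, smul_smul, ← Complex.ofReal_mul]
  have hκs : star (((s * ε : ℝ) : ℂ)) = ((s * ε : ℝ) : ℂ) := Complex.conj_ofReal _
  have habsη : abs (Real.sqrt |ε|) = Real.sqrt |ε| := abs_of_nonneg (Real.sqrt_nonneg _)
  have hεη : |ε| ≤ Real.sqrt |ε| := by
    have h1 : |ε| * |ε| ≤ |ε| := mul_le_of_le_one_left (abs_nonneg ε) hε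
    calc |ε| = Real.sqrt (|ε| * |ε|) := (Real.sqrt_mul_self (abs_nonneg ε)).symm
      _ ≤ Real.sqrt |ε| := Real.sqrt_le_sqrt h1
  have hκε : ‖(((s * ε : ℝ) : ℂ))‖ ≤ abs (Real.sqrt |ε|) := by
    rw [Complex.norm_real, Real.norm_eq_abs, abs_mul, habsη]
    have hs1 : |s| ≤ 1 := abs_le.mpr ⟨by linarith [hs.1], hs.2⟩
    exact (mul_le_of_le_one_left (abs_nonneg ε) hs1).trans hεη
  have hAn' : ∀ Z ℓ (p : ℕ), ‖A Z ℓ‖ ≤ abs (Real.sqrt |ε|) * (Bd p / ((ℓ : ℝ) + 1) ^ p) := by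
    intro Z ℓ p; rw [habsη]; exact hAn Z ℓ p
  obtain ⟨G, instG, c, Y, hid, hYs, hYh, hYc, hYn, hN⟩ :=
    exists_termwise_of_flow_decomposition r₀ r c₁ c₂ hc₁ hc₂ hU hUP Fs F0 hFs_add hFs_smul hFs_H
      hFs_comm hF0_add hF0_smul hF0_H hF0_comm A B hAsum hBsum hAs hBs hAh hBh hκs hκε hAn' hBn
  have hYn' : ∀ g ℓ (p : ℕ), ‖Y g ℓ‖ ≤ Real.sqrt |ε| * (Bd p / ((ℓ : ℝ) + 1) ^ p) := by
    intro g ℓ p; rw [← habsη]; exact hYn g ℓ p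
  refine ⟨U, G, instG, c, Y, hU, ?_, hYs, hYh, hYc, hYn', hN⟩
  rw [hHs, hid, localHamiltonian_univ_eq_sum]

/-- **Smoothing form (filter first), prefactor `√|ε|`** (copy of
`michalakis_zwolak_of_flow_locality_core'`).
[cite: MichalakisZwolakCMP2013, Thm. 1, §5.1–5.2 (arXiv:1109.1588 pp. 6–12)] -/
theorem michalakis_zwolak_of_flow_locality_core_sqrt
    (hS : ∀ (Φ : (L : ℕ) → Interaction (TorusSite d L × κ) q) (m : ℕ → ℕ) (γ : ℝ) (r₀ : ℕ)
      (Δ γloc : ℕ → ℝ),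
      (∀ (L : ℕ) [NeZero L], IsProjectorInteraction (Φ L) ∧ (Φ L).IsLocal) →
      (∀ (L : ℕ) [NeZero L], IsFrustrationFree (Φ L) univ) →
      (∀ (L : ℕ) [NeZero L] (X : Finset (TorusSite d L × κ)), r₀ < torusDiam X → Φ L X = 0) →
      (0 < γ ∧ ∀ (L : ℕ) [NeZero L], (localHamiltonian (Φ L) univ).HasClusterGap (m L) 0 γ) →
      HasUniformLTQO Φ Δ → HasFastDecay Δ → HasUniformLocalGap Φ γloc →
      (∃ c : ℝ, ∃ p : ℕ, 0 < c ∧ ∀ ℓ : ℕ, c / ((ℓ : ℝ) + 1) ^ p ≤ γloc ℓ) →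
      ∀ (r : ℕ) (V : (L : ℕ) → Interaction (TorusSite d L × κ) q),
        (∀ (L : ℕ) [NeZero L], (V L).IsLocal ∧
          (∀ X, r < torusDiam X → V L X = 0) ∧ ∀ X, ‖V L X‖ ≤ 1) →
        ∀ w : 𝓢(ℝ, ℂ), (∫ t : ℝ, w t) = 1 →
          (∀ D : ℝ, γ / 2 ≤ |D| → ∫ t : ℝ, cexp (t * D * I) * w t = 0) →
          (∀ t : ℝ, starRingEnd ℂ (w t) = w t) →
        ∃ L_A : ℕ, ∃ Bd : ℕ → ℝ,
          ∀ ε : ℝ, |ε| ≤ 1 → ∀ (L : ℕ) [NeZero L], L_A ≤ L → ∀ s ∈ Set.Icc (0 : ℝ) 1,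
            (∀ t ∈ Set.Icc (0 : ℝ) s, ∃ ω : ℝ, ω ≤ γ ∧
              (localHamiltonian (Φ L) univ +
                (t : ℂ) • ((ε : ℂ) • localHamiltonian (V L) univ)).HasClusterGap (m L) ω (γ / 2)) →
            ∃ (U : Op (TorusSite d L × κ) q) (S : Finset (TensorIndex (TorusSite d L × κ) q))
              (c₁ c₂ : Finset (TorusSite d L × κ) → TorusSite d L)
              (A B : Finset (TorusSite d L × κ) → ℕ → Op (TorusSite d L × κ) q),
              U ∈ unitary (Op (TorusSite d L × κ) q) ∧
              (∀ hHs : (∑ Z, Φ L Z + ((s * ε : ℝ) : ℂ) • ∑ Z, V L Z).IsHermitian,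
                (∀ k ∈ S, ∀ l ∉ S, γ / 2 ≤ |hHs.eigenvalues k - hHs.eigenvalues l|) ∧
                star U * projMatrix (Submodule.span ℂ (Set.range fun i : S =>
                  hHs.eigenvectorBasis i)) * U = localGroundProj (Φ L) univ) ∧
              (∀ Z, Φ L Z ≠ 0 → Z ⊆ cellBall (c₁ Z) r₀) ∧
              (∀ Z, V L Z ≠ 0 → Z ⊆ cellBall (c₂ Z) r) ∧
              (∀ Z, Φ L Z ≠ 0 → ∑ ℓ ∈ range (L + 1), A Z ℓ =
                star U * (∫ t : ℝ, w t • heisenbergEvolution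
                  (∑ Z, Φ L Z + ((s * ε : ℝ) : ℂ) • ∑ Z, V L Z) t (Φ L Z)) * U -
                  ∫ t : ℝ, w t • heisenbergEvolution (∑ Z, Φ L Z) t (Φ L Z)) ∧
              (∀ Z, V L Z ≠ 0 → ∑ ℓ ∈ range (L + 1), B Z ℓ =
                star U * (∫ t : ℝ, w t • heisenbergEvolution
                  (∑ Z, Φ L Z + ((s * ε : ℝ) : ℂ) • ∑ Z, V L Z) t (V L Z)) * U) ∧
              (∀ Z ℓ, IsSupportedOn (A Z ℓ) (cellBall (c₁ Z) ℓ)) ∧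
              (∀ Z ℓ, IsSupportedOn (B Z ℓ) (cellBall (c₂ Z) ℓ)) ∧
              (∀ Z ℓ, (A Z ℓ).IsHermitian) ∧ (∀ Z ℓ, (B Z ℓ).IsHermitian) ∧
              (∀ Z ℓ (p : ℕ), ‖A Z ℓ‖ ≤ Real.sqrt |ε| * (Bd p / ((ℓ : ℝ) + 1) ^ p)) ∧
              (∀ Z ℓ (p : ℕ), ‖B Z ℓ‖ ≤ Bd p / ((ℓ : ℝ) + 1) ^ p)) :
    michalakis_zwolak (κ := κ) d q := by
  refine michalakis_zwolak_of_flow_decomposition_core_sqrt d q ?_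
  intro Φ m γ r₀ Δ γloc hproj hff hrange hgap hltqo hΔ hloc hγloc r V hV
  have hγ : 0 < γ := hgap.1
  obtain ⟨w, hw1, hw2, hw3⟩ := exists_schwartz_filter (half_pos hγ)
  obtain ⟨L_A, Bd, hcore⟩ :=
    hS Φ m γ r₀ Δ γloc hproj hff hrange hgap hltqo hΔ hloc hγloc r V hV w hw1 hw2 hw3
  refine ⟨L_A, Bd, ?_⟩
  intro ε hε L _ hL s hs hprev
  obtain ⟨U, S, c₁, c₂, A, B, hU, hflow, hc₁, hc₂, hAsum, hBsum, hAs, hBs, hAh, hBh, hAn, hBn⟩ :=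
    hcore ε hε L hL s hs hprev
  -- the Hamiltonians and their hermiticity
  set H₀ : Op (TorusSite d L × κ) q := ∑ Z, Φ L Z with hH₀def
  set Hs : Op (TorusSite d L × κ) q := ∑ Z, Φ L Z + ((s * ε : ℝ) : ℂ) • ∑ Z, V L Z with hHsdef
  have hH₀eq : localHamiltonian (Φ L) univ = H₀ := localHamiltonian_univ_eq_sum _
  have hH₀h : H₀.IsHermitian := by
    rw [← hH₀eq]; exact localHamiltonian_isHermitian (hproj L).2 univ
  have hV₁h : (∑ Z, V L Z).IsHermitian := by
    rw [← localHamiltonian_univ_eq_sum]; exact localHamiltonian_isHermitian (hV L).1 univ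
  have hHsh : Hs.IsHermitian := hH₀h.add (isHermitian_ofReal_smul hV₁h _)
  obtain ⟨hsep, hUP⟩ := hflow hHsh
  have hwi : Integrable (fun t : ℝ => w t) := w.integrable
  -- the smoothing maps
  set Fs : Op (TorusSite d L × κ) q → Op (TorusSite d L × κ) q :=
    fun O => ∫ t : ℝ, w t • heisenbergEvolution Hs t O with hFsdef
  set F0 : Op (TorusSite d L × κ) q → Op (TorusSite d L × κ) q :=
    fun O => ∫ t : ℝ, w t • heisenbergEvolution H₀ t O with hF0def
  set Ps : Op (TorusSite d L × κ) q :=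
    projMatrix (Submodule.span ℂ (Set.range fun i : S => hHsh.eigenvectorBasis i)) with hPsdef
  refine ⟨U, Ps, Fs, F0, c₁, c₂, A, B, hU, hUP, ?_, ?_, ?_, ?_, ?_, ?_, ?_, ?_, hc₁, hc₂,
    ?_, ?_, hAs, hBs, hAh, hBh, hAn, hBn⟩
  · exact fun X Y => integral_smul_heisenbergEvolution_add hHsh hwi X Y
  · exact fun a X => integral_smul_heisenbergEvolution_smul Hs w a X
  · -- `𝓕^s(H_s) = H_s`
    show (∫ t : ℝ, w t • heisenbergEvolution Hs t Hs) = Hs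
    rw [integral_smul_heisenbergEvolution_self, hw1, one_smul]
  · exact fun O => commute_integral_smul_heisenbergEvolution_projMatrix hHsh hwi hw2 S hsep O
  · exact fun X Y => integral_smul_heisenbergEvolution_add hH₀h hwi X Y
  · exact fun a X => integral_smul_heisenbergEvolution_smul H₀ w a X
  · show (∫ t : ℝ, w t • heisenbergEvolution H₀ t H₀) = H₀
    rw [integral_smul_heisenbergEvolution_self, hw1, one_smul]
  · -- `[𝓕⁰(O), P₀] = 0`: `P₀` is the separated projection onto the eigenvalues `≤ 0`
    intro O
    have hgapL : (localHamiltonian (Φ L) univ).HasClusterGap (m L) 0 γ := hgap.2 L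
    have hHh' : (localHamiltonian (Φ L) univ).IsHermitian :=
      localHamiltonian_isHermitian (hproj L).2 univ
    have hsep0 := separated_ground_indices (hproj L).1 hgapL hHh'
    have hsep0' : ∀ k ∈ ({k | hHh'.eigenvalues k ≤ 0} : Finset (TensorIndex (TorusSite d L × κ) q)),
        ∀ l ∉ ({k | hHh'.eigenvalues k ≤ 0} : Finset (TensorIndex (TorusSite d L × κ) q)),
          γ / 2 ≤ |hHh'.eigenvalues k - hHh'.eigenvalues l| :=
      fun k hk l hl => (half_le_self hγ.le).trans (hsep0 k hk l hl)
    have hc := commute_integral_smul_heisenbergEvolution_projMatrix hHh' hwi hw2 _ hsep0' O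
    -- identify the separated projection with `P₀`
    have hP0 : localGroundProj (Φ L) univ = projMatrix (Submodule.span ℂ (Set.range fun i :
        ({k | hHh'.eigenvalues k ≤ 0} : Finset (TensorIndex (TorusSite d L × κ) q)) =>
          hHh'.eigenvectorBasis i)) := by
      rcases isEmpty_or_nonempty (TensorIndex (TorusSite d L × κ) q) with hemp | hne
      · exact Subsingleton.elim _ _
      · obtain ⟨c₀, p₀, hc₀, hγloc'⟩ := hγloc
        exact localGroundProj_univ_eq_projMatrix_span (hproj L).1 (hloc L) hHh' le_rfl
          (lt_of_lt_of_le (by positivity) (hγloc' L))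
    rw [hP0]
    show Commute (∫ t : ℝ, w t • heisenbergEvolution H₀ t O) _
    rw [← hH₀eq]
    exact hc
  · intro Z hZ
    exact hAsum Z hZ
  · intro Z hZ
    exact hBsum Z hZ

/-- **Locality form (spectral flow discharged), prefactor `√|ε|`** (copy of
`michalakis_zwolak_of_locality_core`).
[cite: MichalakisZwolakCMP2013, Thm. 1, §5.1–5.2 (arXiv:1109.1588 pp. 6–12)] -/
theorem michalakis_zwolak_of_locality_core_sqrt
    (hL : ∀ (Φ : (L : ℕ) → Interaction (TorusSite d L × κ) q) (m : ℕ → ℕ) (γ : ℝ) (r₀ : ℕ)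
      (Δ γloc : ℕ → ℝ),
      (∀ (L : ℕ) [NeZero L], IsProjectorInteraction (Φ L) ∧ (Φ L).IsLocal) →
      (∀ (L : ℕ) [NeZero L], IsFrustrationFree (Φ L) univ) →
      (∀ (L : ℕ) [NeZero L] (X : Finset (TorusSite d L × κ)), r₀ < torusDiam X → Φ L X = 0) →
      (0 < γ ∧ ∀ (L : ℕ) [NeZero L], (localHamiltonian (Φ L) univ).HasClusterGap (m L) 0 γ) →
      HasUniformLTQO Φ Δ → HasFastDecay Δ → HasUniformLocalGap Φ γloc →
      (∃ c : ℝ, ∃ p : ℕ, 0 < c ∧ ∀ ℓ : ℕ, c / ((ℓ : ℝ) + 1) ^ p ≤ γloc ℓ) →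
      ∀ (r : ℕ) (V : (L : ℕ) → Interaction (TorusSite d L × κ) q),
        (∀ (L : ℕ) [NeZero L], (V L).IsLocal ∧
          (∀ X, r < torusDiam X → V L X = 0) ∧ ∀ X, ‖V L X‖ ≤ 1) →
        ∀ w : 𝓢(ℝ, ℂ), (∫ t : ℝ, w t) = 1 →
          (∀ D : ℝ, γ / 2 ≤ |D| → ∫ t : ℝ, cexp (t * D * I) * w t = 0) →
          (∀ t : ℝ, starRingEnd ℂ (w t) = w t) →
        ∀ W : ℝ → ℂ, AEStronglyMeasurable W volume →
          (∀ k : ℕ, ∃ M : ℝ, ∀ t : ℝ, |t| ^ k * ‖W t‖ ≤ M) →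
          (∀ k : ℕ, Integrable fun t : ℝ => ‖t‖ ^ k * ‖W t‖) → Integrable W →
          (∀ D : ℝ, γ / 4 ≤ |D| → ∫ t : ℝ, cexp (t * D * I) * W t = I / D) →
          (∀ t : ℝ, starRingEnd ℂ (W t) = W t) →
        ∃ L_A : ℕ, ∃ Bd : ℕ → ℝ,
          ∀ ε : ℝ, |ε| ≤ 1 → ∀ (L : ℕ) [NeZero L], L_A ≤ L → ∀ s ∈ Set.Icc (0 : ℝ) 1,
            (∀ t ∈ Set.Icc (0 : ℝ) s, ∃ ω : ℝ, ω ≤ γ ∧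
              (localHamiltonian (Φ L) univ +
                (t : ℂ) • ((ε : ℂ) • localHamiltonian (V L) univ)).HasClusterGap (m L) ω (γ / 2)) →
            ∀ U : ℝ → Op (TorusSite d L × κ) q, U 0 = 1 →
              (∀ t ∈ Set.Icc (0 : ℝ) s, HasDerivWithinAt U
                (((Complex.I : ℂ) • ∫ τ : ℝ, W τ • heisenbergEvolution
                    (∑ Z, Φ L Z + t • ((ε : ℂ) • ∑ Z, V L Z)) τ ((ε : ℂ) • ∑ Z, V L Z)) * U t)
                (Set.Icc 0 s) t) →
              (∀ t ∈ Set.Icc (0 : ℝ) s, (U t)ᴴ * U t = 1) →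
              (∀ t ∈ Set.Icc (0 : ℝ) s, U t * (U t)ᴴ = 1) →
              ∃ (c₁ c₂ : Finset (TorusSite d L × κ) → TorusSite d L)
                (A B : Finset (TorusSite d L × κ) → ℕ → Op (TorusSite d L × κ) q),
                (∀ Z, Φ L Z ≠ 0 → Z ⊆ cellBall (c₁ Z) r₀) ∧
                (∀ Z, V L Z ≠ 0 → Z ⊆ cellBall (c₂ Z) r) ∧
                (∀ Z, Φ L Z ≠ 0 → ∑ ℓ ∈ range (L + 1), A Z ℓ =
                  star (U s) * (∫ t : ℝ, w t • heisenbergEvolution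
                    (∑ Z, Φ L Z + s • ((ε : ℂ) • ∑ Z, V L Z)) t (Φ L Z)) * U s -
                    ∫ t : ℝ, w t • heisenbergEvolution (∑ Z, Φ L Z) t (Φ L Z)) ∧
                (∀ Z, V L Z ≠ 0 → ∑ ℓ ∈ range (L + 1), B Z ℓ =
                  star (U s) * (∫ t : ℝ, w t • heisenbergEvolution
                    (∑ Z, Φ L Z + s • ((ε : ℂ) • ∑ Z, V L Z)) t (V L Z)) * U s) ∧
                (∀ Z ℓ, IsSupportedOn (A Z ℓ) (cellBall (c₁ Z) ℓ)) ∧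
                (∀ Z ℓ, IsSupportedOn (B Z ℓ) (cellBall (c₂ Z) ℓ)) ∧
                (∀ Z ℓ, (A Z ℓ).IsHermitian) ∧ (∀ Z ℓ, (B Z ℓ).IsHermitian) ∧
                (∀ Z ℓ (p : ℕ), ‖A Z ℓ‖ ≤ Real.sqrt |ε| * (Bd p / ((ℓ : ℝ) + 1) ^ p)) ∧
                (∀ Z ℓ (p : ℕ), ‖B Z ℓ‖ ≤ Bd p / ((ℓ : ℝ) + 1) ^ p)) :
    michalakis_zwolak (κ := κ) d q := by
  refine michalakis_zwolak_of_flow_locality_core_sqrt d q ?_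
  intro Φ m γ r₀ Δ γloc hproj hff hrange hgap hltqo hΔ hloc hγloc r V hV w hw1 hw2 hw3
  have hγ : 0 < γ := hgap.1
  -- one flow weight for all volumes and couplings
  have hγ4 : 0 < γ / 4 := by positivity
  obtain ⟨W, hWm, hWmom, hWmomi, hWi, hW, hWr⟩ := exists_spectralFlowWeight hγ4
  obtain ⟨L_A, Bd, hcore⟩ := hL Φ m γ r₀ Δ γloc hproj hff hrange hgap hltqo hΔ hloc hγloc r V hV
    w hw1 hw2 hw3 W hWm hWmom hWmomi hWi hW hWr
  refine ⟨L_A, Bd, ?_⟩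
  intro ε hε L _ hL1 s hs hprev
  -- the affine path `H_t = H₀' + t X'`
  set H₀' : Op (TorusSite d L × κ) q := ∑ Z, Φ L Z with hH₀'def
  set X' : Op (TorusSite d L × κ) q := (ε : ℂ) • ∑ Z, V L Z with hX'def
  have hH₀eq : localHamiltonian (Φ L) univ = H₀' := localHamiltonian_univ_eq_sum _
  have hV₁eq : localHamiltonian (V L) univ = ∑ Z, V L Z := localHamiltonian_univ_eq_sum _
  have hH₀'h : H₀'.IsHermitian := by
    rw [← hH₀eq]; exact localHamiltonian_isHermitian (hproj L).2 univ
  have hV₁h : (∑ Z, V L Z).IsHermitian := by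
    rw [← hV₁eq]; exact localHamiltonian_isHermitian (hV L).1 univ
  have hX'h : X'.IsHermitian := isHermitian_ofReal_smul hV₁h ε
  -- the two syntactic forms of the perturbed Hamiltonian
  have hpath : ∀ t : ℝ, localHamiltonian (Φ L) univ +
      (t : ℂ) • ((ε : ℂ) • localHamiltonian (V L) univ) = H₀' + t • X' := by
    intro t
    rw [hH₀eq, hV₁eq, Complex.coe_smul]
  have hHsEq : (∑ Z, Φ L Z + ((s * ε : ℝ) : ℂ) • ∑ Z, V L Z) = H₀' + s • X' := by
    rw [hX'def, ← Complex.coe_smul, smul_smul, ← Complex.ofReal_mul]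
  -- the gap along the path in affine form
  have hgap' : ∀ t ∈ Set.Icc (0 : ℝ) s, ∃ ω : ℝ, (H₀' + t • X').HasClusterGap (m L) ω (γ / 2) := by
    intro t ht
    obtain ⟨ω, -, hω⟩ := hprev t ht
    exact ⟨ω, by rwa [hpath t] at hω⟩
  -- the spectral flow for the fixed weight
  have hW' : ∀ D : ℝ, γ / 2 / 2 ≤ |D| → ∫ t : ℝ, cexp (t * D * I) * W t = I / D := by
    intro D hD; exact hW D (by linarith)
  obtain ⟨U, hU0, hUd, hU1, hU2, hUP⟩ :=
    exists_spectral_flow_of_weight hH₀'h hX'h hWi hW' hWr hgap'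
  -- the locality estimates from the analytic side, for this flow
  obtain ⟨c₁, c₂, A, B, hc₁, hc₂, hAsum, hBsum, hAs, hBs, hAh, hBh, hAn, hBn⟩ :=
    hcore ε hε L hL1 s hs hprev U hU0 hUd hU1 hU2
  have hsmem : s ∈ Set.Icc (0 : ℝ) s := ⟨hs.1, le_rfl⟩
  have hUs : U s ∈ unitary (Op (TorusSite d L × κ) q) := by
    rw [Unitary.mem_iff, star_eq_conjTranspose]; exact ⟨hU1 s hsmem, hU2 s hsmem⟩
  set hHt := isHermitian_affinePath hH₀'h hX'h with hhHt
  refine ⟨U s, (univ.filter fun k => (univ.filter fun l =>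
      (hHt s).eigenvalues l ≤ (hHt s).eigenvalues k).card ≤ m L), c₁, c₂, A, B, hUs, ?_, hc₁, hc₂,
    ?_, ?_, hAs, hBs, hAh, hBh, hAn, hBn⟩
  · -- separation and intertwining
    intro hHs
    have hev : hHs.eigenvalues = (hHt s).eigenvalues := eigenvalues_eq_of_eq hHsEq hHs (hHt s)
    have heb : hHs.eigenvectorBasis = (hHt s).eigenvectorBasis :=
      eigenvectorBasis_eq_of_eq hHsEq hHs (hHt s)
    obtain ⟨ωs, hωs⟩ := hgap' s hsmem
    refine ⟨?_, ?_⟩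
    · rw [hev]
      exact clusterSet_separated (hHt s) hωs
    · rw [heb, star_eq_conjTranspose, hUP s hsmem]
      -- the cluster projection at `t = 0` is `P₀`
      obtain ⟨ω0, hω0⟩ := hgap' 0 ⟨le_rfl, hs.1⟩
      have e0 : H₀' + (0 : ℝ) • X' = localHamiltonian (Φ L) univ := by
        rw [zero_smul, add_zero, hH₀eq]
      obtain ⟨c₀, p₀, hc₀, hγloc'⟩ := hγloc
      exact clusterProj_zero_eq_localGroundProj (hproj L).1 (hloc L)
        (lt_of_lt_of_le (by positivity) (hγloc' L)) (hgap.2 L) e0 (hHt 0) hω0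
  · -- the `Φ`-terms: same statement up to the syntactic form of `H_s`
    intro Z hZ
    rw [hAsum Z hZ, hHsEq]
  · intro Z hZ
    rw [hBsum Z hZ, hHsEq]

end Literature.MathematicalPhysics.QuantumLattice
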